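import Mathlib
import HarnessLib
import Summits.HubbardSuperconductivity.HubbardSuperconductivity.Theses.KLProgramme
import Summits.HubbardSuperconductivity.HubbardSuperconductivity.Theorems.KLProgrammeKLRegimeCountertermOneVolumeMs

/-!
# Route `KLProgramme` — crux `KLRegimeCountertermV11` (stmt-HubbardSuperconductivity-19825, gen-3 K3 resplit on `klPredsV11`) — CLOSED

The COUNTERTERM child `CountertermP2 klPredsV11 klWindowC` of crux K3 `KLRegimeTwoPointLimit`: ONE admissible frame `K`, chosen before the
volume, renormalised (`RenormalisedAtF`, quadratic tolerance) at every scale and every large volume.  Composition of record (skeleton BC3,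
k3c5-p1 g2): the volume transfer by (E3f) (`KLRegimeSplit.countertermP2_klPredsV11_of_ms`, `…CountertermV11Volume`) applied to the one-volume
construction `KLRegimeSplit.CtOneVolumeMsV11 G P Q`, which is PROVED for all well-formed constants by the wholesale continuation
(`KLRegimeSplit.ctOneVolumeMsV11_holds`, `…CountertermOneVolumeMs`: one Picard step per scale on FrameOK's tube — self-map by (E3a-MS) Δ20,
contraction by (E3c), reading by (E3g) Δ18 + the off-lattice wiggle; seats hubbard-kl-k3c3-p2 / -p1 / -p3, p1b, p2, k3c5-p1).  The registered
stub `stub_ct_oneVolume` is `ctOneVolumeMsV11_holds` (same signature; cited, not restated).  Proof only.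
-/

noncomputable section

namespace Summit.HubbardSuperconductivity.HubbardSuperconductivity.Theorems.KLRegimeCounterterm

set_option linter.dupNamespace false -- summit = problem name (single-conjunct summit), D-0017

open Summit.HubbardSuperconductivity.HubbardSuperconductivity.Theorems.KLRegimeSplit

/-- **The counterterm child of the gen-3 K3 resplit, BY NAME**: `KLRegimeCountertermV11` (`= CountertermP2 klPredsV11 klWindowC`), from the
proved one-volume construction (`ctOneVolumeMsV11_holds` = the registered stub `stub_ct_oneVolume`) and the proved volume transfer. -/
theorem KLRegimeCountertermV11_of :
    Summit.HubbardSuperconductivity.HubbardSuperconductivity.Theses.KLProgramme.KLRegimeCountertermV11 :=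
  countertermP2_klPredsV11_of_ms ctOneVolumeMsV11_holds

end Summit.HubbardSuperconductivity.HubbardSuperconductivity.Theorems.KLRegimeCounterterm

end
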